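import Summits.QuantumFields.BalabanUV.Beta.FP.RelInvPeriodisedEffForm

/-!
# `BalabanUV.Beta.FP.RelInvPeriodisedEffFormCoarse` — road «FP» (binder row D1), ROUTE T row **(T-INV)** ∕ § B (iv), sequel of `RelInvPeriodisedEffForm`:
# THE DICTIONARY'S IDENTIFICATION `hId` AT ORDER 0 AS A THEOREM (`hId_order_zero`) AND THE SECOND (INV) LETTER UNCONDITIONALLY (`torus_h2`)

HONEST DEPENDENCY (page 1, mandatory): continuum YM on T⁴ ⇐ BetaPertH ∧ nine spine estimates (0/9 proved); BetaPertH ⇐ (D1) ∧ (D4) ∧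
CAP+tail; G-an2-4 gates asym, D1 and NE2/3/4.  HONEST FRAMING (cell contract, verbatim): «discharging `BetaPertH` makes Bałaban's UV
stability UNCONDITIONAL — a real constructive-QFT result; it is NOT the continuum limit and NOT the Clay problem.»  ABSOLUTE RULE (cell
charter, verbatim): «No internally-minted statement may enter as a cited fact. Every hypothesis is either kernel-proved in this package or a
verbatim quotation of a PUBLISHED theorem with page reference. The manuscript(s) under audit are NOT citable for their own disputed steps — they
are the thing under adjudication; programme-internal (2001/route/tribunal) claims are never citable.»  THIS MODULE is [folklore] bookkeeping BY
NAME over `RelInvPeriodisedEffForm.effForm_toBlocks₁₁_eq_perF_KInvStep` ((E), same unit), `RelInvPeriodisedCoarse.coarse_det_kkt_ne_zero` (p313296),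
`OneStepKernelFamily.KInvStep Lc j := dec (Lc^j) (KInv (Lc^(j+1)))`, `BalabanStepJetsSucc.E2 (j+1) := mmRead (Lc^(j+1)) (KInv (Lc^(j+1)))` ∕ `wVH`,
`BorderedHessian.bhKStepAt_succ_inl_inl` (field block `= wVH · E2`), `B5Prop11Plancherel.fine`.  No `Prop`, no `def`, nothing cited, 0 sorry.  «not in print; our bookkeeping».

CONTENT.
* §4 reading arithmetic (R): `dec_inr_inr`, `KInvStep_inr_inr`, `E2_inl_inl` (`rfl`), **`KInvStep_coarse_inr_inr_eq_E2`** (`KInvStep Lc j (Lc•x̄) (Lc•ȳ) (inr m) (inr m')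
  = E2 d Lc (j+1) x̄ ȳ (inl m) (inl m')`), `translate_fine_smul`, **`perF_KInvStep_coarse_eq_perF_E2`** (on `fine Lc M′`, multiplier slots at the coarse points `Lc • p̄`:
  `perF (fine Lc M′) (KInvStep Lc j) = perF M′ (E2 (j+1))` on the coarse box's field slots — termwise, no convergence).
* §5 (F) `perF_bhKStepAt_succ_inl_inl` (`= wVH (j+1) · perF M′ (E2 (j+1))` on field slots, any root), `wVH_pos`; **(ID) `hId_order_zero`**: for any `fμ`
  reading the coarse points through `g : μ → ↥(pbox M′) × Fin (d+1)` (`hg`), `(effForm H₀ [Q₁₀;τ₁]).toBlocks₁₁ = (wVH d Lc (j+1))⁻¹ • (perF M′ (bhKStepAt d (toSite r′) Lc (j+1)))∘(fields∘g, fields∘g)`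
  (ANY coarse root `r′`); **(H2) `torus_h2`**: `g` bijective, `r′ ∈ box (d+1) Lc`, `Lc ∣ M′ᵢ`, any injective coarse-coarse presentation `fμ′` ⇒
  `det kkt ((effForm H₀ [Q₁₀;τ₁]).toBlocks₁₁) [P̂′∘(fμ′, fields∘g); combRowsT (toSite r′) Lc M′∘(·, fields∘g)] ≠ 0` — § B (iv) SECOND (INV) AS A THEOREM for the `G₀ = 0`
  system (the `U = 1` composite is δ-constrained: no block weight; a displayed `G₀` shifts `effForm` by `CompositionSingular.effForm_add_conj`, not here);
  **`torus_h2_record` ∕ `hId_order_zero_record`** = the same AT THE INDEX TYPES OF RECORD of the OWNER's `NestedStepLawTorusInstance` v2 (p313662: coarse multipliers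
  `(p̄, κ) ↦ (cp p̄, inr κ)`, `cp p̄ = Lc • p̄` = gan24-leaf-05's `coarsePt M′ Lc` by `coarsePt_coe`; `g := id`).
WHAT IT IS NOT: NOT orders 1–2 of the dictionary (the jets `G₁ G₂`, `SrecOf_succ`'s cubic ∕ quartic slots — Q-FP-16-5 proper, an2); NOT the READING of
`KInvStep` as the genuine step-`j` covariance (`OneStepKernelFamily`'s docstring promise — not needed); NOT (T-ID), NOT SDF, NOT D1, NOT BetaPertH, NOT
continuum, NOT Clay; discharges NO binder of row D1 by itself; 0 estimates.  Unit `b2b-balaban-beta-d1-formalise-leaf-05` (gen 25), 2026-08-22.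
-/

noncomputable section

open scoped BigOperators Matrix

namespace Summit.QuantumFields.BalabanUV.Beta.FP.RelInvPeriodisedEffFormCoarse

open Matrix
open Literature.Probability.LatticeModels (Torus.proj)
open Literature.MathematicalPhysics.QuantumFieldTheory.Balaban1983to89
open Literature.MathematicalPhysics.QuantumFieldTheory.Balaban1983to89.Beta
open Literature.MathematicalPhysics.QuantumFieldTheory.Balaban1983to89.Beta.Composition (kkt)
open Literature.MathematicalPhysics.QuantumFieldTheory.Balaban1983to89.Beta.CompositionSingular (effForm)
open B4TorusKernel.MultiPeriod (translate)
open B5Prop11Plancherel (fine)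
open B6Lemma24Torus (pbox)
open ExpKernelCalculus (MKer)
open AffineAveraging (Site box toSite)
open OneStepResolventKernel (Fib KInv)
open OneStepKernelFamily (KInvStep dec legSet legPt legW)
open BalabanStepJetsSucc (E2 wVH)
open Summit.QuantumFields.BalabanUV.Beta.BorderedHessian (bhKStepAt bhKStepAt_succ_inl_inl)
open Summit.QuantumFields.BalabanUV.Beta.FP.KernelPeriodisationFib (Idx perF perF_apply perZ_apply)
open Summit.QuantumFields.BalabanUV.Beta.FP.TorusCombRows (Res combRowsT)
open Summit.QuantumFields.BalabanUV.Beta.FP.RelInvPeriodisedCoarse (coarse_det_kkt_ne_zero)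
open Summit.QuantumFields.BalabanUV.Beta.FP.RelInvPeriodisedEffForm (effForm_toBlocks₁₁_eq_perF_KInvStep)

/-! ## §4 Reading arithmetic: decimation on multiplier legs, `mmRead`, and the coarse points of `fine Lc M′` -/

section Reading

variable {d : ℕ} {Lc : ℕ} [NeZero Lc]

/-- [folklore] Decimation on multiplier–multiplier legs reads the kernel at the coarse points `M•x′`, `M•y′` with weight `1`. -/
theorem dec_inr_inr (M : ℕ) (K : MKer (d + 1) (Fib d)) (x' y' : Fin (d + 1) → ℤ) (m m' : Fin (d + 1)) :
    dec M K x' y' (Sum.inr m) (Sum.inr m') = K ((M : ℤ) • x') ((M : ℤ) • y') (Sum.inr m) (Sum.inr m') := by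
  simp only [dec, legSet, legPt, legW, Finset.sum_singleton, one_mul]

/-- [folklore] `KInvStep Lc j` on multiplier–multiplier legs = `KInv (Lc^(j+1))` at `Lc^j • x′`, `Lc^j • y′`. -/
theorem KInvStep_inr_inr (j : ℕ) (x' y' : Fin (d + 1) → ℤ) (m m' : Fin (d + 1)) :
    KInvStep (d := d) Lc j x' y' (Sum.inr m) (Sum.inr m')
      = KInv (N := Lc ^ (j + 1)) (d := d) (((Lc ^ j : ℕ) : ℤ) • x') (((Lc ^ j : ℕ) : ℤ) • y') (Sum.inr m) (Sum.inr m') := by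
  unfold OneStepKernelFamily.KInvStep
  exact dec_inr_inr _ _ x' y' m m'

/-- [folklore] `E2 d Lc k` on field–field legs = `KInv (Lc^k)` on multiplier legs at `Lc^k • x̄`, `Lc^k • ȳ`. -/
theorem E2_inl_inl (k : ℕ) (x y : Fin (d + 1) → ℤ) (α β : Fin (d + 1)) :
    E2 d Lc k x y (Sum.inl α) (Sum.inl β) = KInv (N := Lc ^ k) (d := d) (((Lc ^ k : ℕ) : ℤ) • x) (((Lc ^ k : ℕ) : ℤ) • y) (Sum.inr α) (Sum.inr β) := rfl

/-- [folklore] **THE DECIMATED COMPOSITE RESOLVENT AT THE COARSE POINTS IS `E2` ONE LEVEL UP**: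
`KInvStep Lc j (Lc•x̄) (Lc•ȳ) (inr m) (inr m') = E2 d Lc (j+1) x̄ ȳ (inl m) (inl m')`. -/
theorem KInvStep_coarse_inr_inr_eq_E2 (j : ℕ) (x y : Fin (d + 1) → ℤ) (m m' : Fin (d + 1)) :
    KInvStep (d := d) Lc j ((Lc : ℤ) • x) ((Lc : ℤ) • y) (Sum.inr m) (Sum.inr m') = E2 d Lc (j + 1) x y (Sum.inl m) (Sum.inl m') := by
  rw [KInvStep_inr_inr, E2_inl_inl, smul_smul, smul_smul, ← Nat.cast_mul, ← pow_succ]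

omit [NeZero Lc] in
/-- [folklore] A translate of a coarse point of `fine Lc M′` by a period of `fine Lc M′` is `Lc •` a translate of `M′`. -/
theorem translate_fine_smul (M' : Fin (d + 1) → ℕ) (y t : Fin (d + 1) → ℤ) :
    translate (fine Lc M') ((Lc : ℤ) • y) t = (Lc : ℤ) • translate M' y t := by
  funext i
  simp only [B4TorusKernel.MultiPeriod.translate_apply, Pi.smul_apply, smul_eq_mul, fine, Nat.cast_mul]
  ring

variable (M' : Fin (d + 1) → ℕ)

/-- [folklore] **(R) THE PERIODISED MULTIPLIER BLOCK OF `KInvStep Lc j` AT THE COARSE SLOTS OF `fine Lc M′` IS THE PERIODISED FIELD BLOCK OF `E2 (j+1)` ON `M′`** — for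
any slot map `fμ` into `Idx (fine Lc M′) (Fib d)` reading the coarse points through `g : μ → ↥(pbox M′) × Fin (d+1)`
(`hg : (fμ a).1 = Lc • (g a).1 ∧ (fμ a).2 = inr (g a).2`). -/
theorem perF_KInvStep_coarse_eq_perF_E2 (j : ℕ) {μ : Type*} (fμ : μ → Idx (fine Lc M') (Fib d)) (g : μ → ↥(pbox M') × Fin (d + 1))
    (hg : ∀ a, ((fμ a).1 : Site (d + 1)) = (Lc : ℤ) • ((g a).1 : Site (d + 1)) ∧ (fμ a).2 = Sum.inr (g a).2) :
    (perF (fine Lc M') (KInvStep (d := d) Lc j)).submatrix fμ fμ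
      = (perF M' (E2 d Lc (j + 1))).submatrix (fun a => (((g a).1, Sum.inl (g a).2) : Idx M' (Fib d))) (fun a => ((g a).1, Sum.inl (g a).2)) := by
  ext a a'
  obtain ⟨h1, h2⟩ := hg a
  obtain ⟨h1', h2'⟩ := hg a'
  rw [submatrix_apply, submatrix_apply, perF_apply, perF_apply, perZ_apply, perZ_apply, h1, h1', h2, h2']
  refine tsum_congr fun t => ?_
  rw [translate_fine_smul, KInvStep_coarse_inr_inr_eq_E2]

end Reading

/-! ## §5 (F) the level-`(j+1)` field block, (ID) `hId` at order 0, (H2) the second (INV) letter unconditionally -/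

section Identification

variable {d : ℕ} {Lc : ℕ} [NeZero Lc] {r r' : Fin (d + 1) → ℕ} (M' : Fin (d + 1) → ℕ) [∀ i, NeZero (M' i)]

omit [∀ i, NeZero (M' i)] in
/-- [folklore] **(F) THE PERIODISED LEVEL-`(j+1)` FIELD BLOCK IS `wVH (j+1) ×` THE PERIODISED `E2 (j+1)`** (entrywise on field slots, any root; `tsum_mul_left`). -/
theorem perF_bhKStepAt_succ_inl_inl (ρ : Fin (d + 1) → ℤ) (j : ℕ) (s s' : ↥(pbox M')) (κ l : Fin (d + 1)) :
    perF M' (bhKStepAt d ρ Lc (j + 1)) (s, Sum.inl κ) (s', Sum.inl l) = wVH d Lc (j + 1) * perF M' (E2 d Lc (j + 1)) (s, Sum.inl κ) (s', Sum.inl l) := by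
  rw [perF_apply, perF_apply, perZ_apply, perZ_apply, ← tsum_mul_left]
  exact tsum_congr fun t => bhKStepAt_succ_inl_inl j _ _ κ l

omit [NeZero Lc] in
/-- [folklore] `0 < wVH d Lc k` (`Lc ≠ 0`). -/
theorem wVH_pos (hLc : 0 < Lc) (k : ℕ) : 0 < wVH d Lc k := by
  unfold BalabanStepJetsSucc.wVH
  have : (0 : ℝ) < Lc := by exact_mod_cast hLc
  positivity

set_option synthInstance.maxSize 1024 in
/-- **[folklore] (ID) THE DICTIONARY's IDENTIFICATION `hId` AT ORDER 0, AS A THEOREM.**  On the fine box `fine Lc M′` (level `j`, root `r`), with the coarse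
multipliers presented by any injective `inr`-valued `fμ` whose range is the multiplier slots at the `Lc`-coarse points (`hcoarse`) and which reads those points
through `g : μ → ↥(pbox M′) × Fin (d+1)` (`hg`):
`(effForm H₀ [Q₁₀; τ₁]).toBlocks₁₁ = (wVH d Lc (j+1))⁻¹ • (perF M′ (bhKStepAt d (toSite r′) Lc (j+1)))∘(fields∘g, fields∘g)` — for ANY coarse root `r′`
(the field block does not see the root).  This is the `hId` of `RelInvPeriodisedCoarse.coarse_det_kkt_ne_zero` with `c = (wVH (j+1))⁻¹`, for the `G₀ = 0` system. -/
theorem hId_order_zero (hr : r ∈ box (d + 1) Lc) (j : ℕ) (r' : Fin (d + 1) → ℕ)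
    {μ : Type*} [Fintype μ] [DecidableEq μ] (fμ : μ → Idx (fine Lc M') (Fib d)) (hfμ : Function.Injective fμ)
    (hμ : ∀ a : μ, ∃ m : Fin (d + 1), (fμ a).2 = Sum.inr m)
    (hcoarse : ∀ (s : ↥(pbox (fine Lc M'))) (m : Fin (d + 1)),
      ((s, Sum.inr m) : Idx (fine Lc M') (Fib d)) ∈ Set.range fμ ↔ Torus.proj Lc (s : Site (d + 1)) = 0)
    (g : μ → ↥(pbox M') × Fin (d + 1))
    (hg : ∀ a, ((fμ a).1 : Site (d + 1)) = (Lc : ℤ) • ((g a).1 : Site (d + 1)) ∧ (fμ a).2 = Sum.inr (g a).2) :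
    (effForm ((perF (fine Lc M') (bhKStepAt d (toSite r) Lc j)).submatrix
          (fun b : ↥(pbox (fine Lc M')) × Fin (d + 1) => ((b.1, Sum.inl b.2) : Idx (fine Lc M') (Fib d)))
          (fun b : ↥(pbox (fine Lc M')) × Fin (d + 1) => ((b.1, Sum.inl b.2) : Idx (fine Lc M') (Fib d))))
        (fromRows
          ((perF (fine Lc M') (bhKStepAt d (toSite r) Lc j)).submatrix fμ
            (fun b : ↥(pbox (fine Lc M')) × Fin (d + 1) => ((b.1, Sum.inl b.2) : Idx (fine Lc M') (Fib d))))
          ((combRowsT (toSite r) Lc (fine Lc M')).submatrix id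
            (fun b : ↥(pbox (fine Lc M')) × Fin (d + 1) => ((b.1, Sum.inl b.2) : Idx (fine Lc M') (Fib d)))))).toBlocks₁₁
      = (wVH d Lc (j + 1))⁻¹ • (perF M' (bhKStepAt d (toSite r') Lc (j + 1))).submatrix
          (fun a : μ => (((g a).1, Sum.inl (g a).2) : Idx M' (Fib d))) (fun a : μ => (((g a).1, Sum.inl (g a).2) : Idx M' (Fib d))) := by
  have hw : wVH d Lc (j + 1) ≠ 0 := (wVH_pos (d := d) (Nat.pos_of_ne_zero (NeZero.ne Lc)) (j + 1)).ne'
  rw [effForm_toBlocks₁₁_eq_perF_KInvStep (fine Lc M') hr (fun i => Dvd.intro (M' i) rfl) j fμ hfμ hμ hcoarse,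
    perF_KInvStep_coarse_eq_perF_E2 M' j fμ g hg]
  ext a a'
  rw [submatrix_apply, Matrix.smul_apply, submatrix_apply, perF_bhKStepAt_succ_inl_inl, smul_eq_mul, ← mul_assoc, inv_mul_cancel₀ hw, one_mul]

set_option synthInstance.maxSize 1024 in
/-- **[folklore] (H2) `TID-LETTER-SPEC` § B (iv) SECOND (INV) LETTER AS A THEOREM** (the `G₀ = 0` system).  With the level-`j` comb-sliced system on `fine Lc M′`
presented as in `hId_order_zero`, `g` BIJECTIVE (at the OWNER's instance `μ := ↥(pbox M′) × Fin (d+1)`, `g := id`), any coarse root `r′ ∈ box (d+1) Lc`,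
`Lc ∣ M′ᵢ`, and the coarse one-step rows presented by any injective `fμ′` (`hμ′ hcoarse′` on `M′`):
`det kkt ((effForm H₀ [Q₁₀;τ₁]).toBlocks₁₁) [P̂′∘(fμ′, fields∘g); combRowsT (toSite r′) Lc M′∘(·, fields∘g)] ≠ 0`,
`P̂′ := perF M′ (bhKStepAt d (toSite r′) Lc (j+1))` — by `hId_order_zero` + `RelInvPeriodisedCoarse.coarse_det_kkt_ne_zero`. -/
theorem torus_h2 (hr : r ∈ box (d + 1) Lc) (j : ℕ) (hr' : r' ∈ box (d + 1) Lc) (hM' : ∀ i, Lc ∣ M' i)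
    {μ : Type*} [Fintype μ] [DecidableEq μ] (fμ : μ → Idx (fine Lc M') (Fib d)) (hfμ : Function.Injective fμ)
    (hμ : ∀ a : μ, ∃ m : Fin (d + 1), (fμ a).2 = Sum.inr m)
    (hcoarse : ∀ (s : ↥(pbox (fine Lc M'))) (m : Fin (d + 1)),
      ((s, Sum.inr m) : Idx (fine Lc M') (Fib d)) ∈ Set.range fμ ↔ Torus.proj Lc (s : Site (d + 1)) = 0)
    (g : μ → ↥(pbox M') × Fin (d + 1))
    (hg : ∀ a, ((fμ a).1 : Site (d + 1)) = (Lc : ℤ) • ((g a).1 : Site (d + 1)) ∧ (fμ a).2 = Sum.inr (g a).2)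
    (hgb : Function.Bijective g)
    {κ : Type*} [Fintype κ] [DecidableEq κ] (fμ' : κ → Idx M' (Fib d)) (hfμ' : Function.Injective fμ')
    (hμ' : ∀ a : κ, ∃ m : Fin (d + 1), (fμ' a).2 = Sum.inr m)
    (hcoarse' : ∀ (s : ↥(pbox M')) (m : Fin (d + 1)), ((s, Sum.inr m) : Idx M' (Fib d)) ∈ Set.range fμ' ↔ Torus.proj Lc (s : Site (d + 1)) = 0) :
    (kkt
      (effForm ((perF (fine Lc M') (bhKStepAt d (toSite r) Lc j)).submatrix
            (fun b : ↥(pbox (fine Lc M')) × Fin (d + 1) => ((b.1, Sum.inl b.2) : Idx (fine Lc M') (Fib d)))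
            (fun b : ↥(pbox (fine Lc M')) × Fin (d + 1) => ((b.1, Sum.inl b.2) : Idx (fine Lc M') (Fib d))))
          (fromRows
            ((perF (fine Lc M') (bhKStepAt d (toSite r) Lc j)).submatrix fμ
              (fun b : ↥(pbox (fine Lc M')) × Fin (d + 1) => ((b.1, Sum.inl b.2) : Idx (fine Lc M') (Fib d))))
            ((combRowsT (toSite r) Lc (fine Lc M')).submatrix id
              (fun b : ↥(pbox (fine Lc M')) × Fin (d + 1) => ((b.1, Sum.inl b.2) : Idx (fine Lc M') (Fib d)))))).toBlocks₁₁
      (fromRows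
        ((perF M' (bhKStepAt d (toSite r') Lc (j + 1))).submatrix fμ' (fun a : μ => (((g a).1, Sum.inl (g a).2) : Idx M' (Fib d))))
        ((combRowsT (toSite r') Lc M').submatrix (Equiv.refl _) (fun a : μ => (((g a).1, Sum.inl (g a).2) : Idx M' (Fib d)))))).det ≠ 0 := by
  have hw : (wVH d Lc (j + 1))⁻¹ ≠ 0 := inv_ne_zero (wVH_pos (d := d) (Nat.pos_of_ne_zero (NeZero.ne Lc)) (j + 1)).ne'
  refine coarse_det_kkt_ne_zero M' hr' hM' (j + 1) fμ' hfμ' hμ' hcoarse'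
    (fun a : μ => (((g a).1, Sum.inl (g a).2) : Idx M' (Fib d))) ?_ (fun a => ⟨(g a).2, rfl⟩) ?_ (Equiv.refl _) hw
    (hId_order_zero M' hr j r' fμ hfμ hμ hcoarse g hg) rfl rfl
  · intro a a' h
    simp only [Prod.mk.injEq, Sum.inl.injEq] at h
    exact hgb.1 (Prod.ext h.1 h.2)
  · intro s α
    obtain ⟨a, ha⟩ := hgb.2 (s, α)
    exact ⟨a, show (((g a).1, Sum.inl (g a).2) : Idx M' (Fib d)) = (s, Sum.inl α) by rw [ha]⟩

set_option synthInstance.maxSize 1024 in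
/-- **[folklore] (H2) AT THE INDEX TYPES OF RECORD** (the OWNER's `NestedStepLawTorusInstance` v2, p313662: `μ := ↥(pbox M′) × Fin (d+1)`, coarse multipliers presented by
`(p̄, κ) ↦ (cp p̄, inr κ)` with `cp p̄ = Lc • p̄` — gan24-leaf-05's `coarsePt M′ Lc`, `coarsePt_coe` — columns of the coarse system read by `(s, α) ↦ (s, inl α)`, slice rows by `id`):
`det kkt ((effForm H₀ [Q₁₀;τ₁]).toBlocks₁₁) [P̂′∘((cp′-free) fμ′, fields); combRowsT (toSite r′) Lc M′∘(id, fields)] ≠ 0`.  With `G₀ = 0` this is the displayed `h2`. -/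
theorem torus_h2_record (hr : r ∈ box (d + 1) Lc) (j : ℕ) (hr' : r' ∈ box (d + 1) Lc) (hM' : ∀ i, Lc ∣ M' i)
    (cp : ↥(pbox M') → ↥(pbox (fine Lc M'))) (hcp : ∀ p : ↥(pbox M'), (cp p : Site (d + 1)) = (Lc : ℤ) • (p : Site (d + 1)))
    (hfμ : Function.Injective (fun a : ↥(pbox M') × Fin (d + 1) => ((cp a.1, Sum.inr a.2) : Idx (fine Lc M') (Fib d))))
    (hcoarse : ∀ (s : ↥(pbox (fine Lc M'))) (m : Fin (d + 1)),
      ((s, Sum.inr m) : Idx (fine Lc M') (Fib d)) ∈ Set.range (fun a : ↥(pbox M') × Fin (d + 1) => ((cp a.1, Sum.inr a.2) : Idx (fine Lc M') (Fib d)))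
        ↔ Torus.proj Lc (s : Site (d + 1)) = 0)
    {κ : Type*} [Fintype κ] [DecidableEq κ] (fμ' : κ → Idx M' (Fib d)) (hfμ' : Function.Injective fμ')
    (hμ' : ∀ a : κ, ∃ m : Fin (d + 1), (fμ' a).2 = Sum.inr m)
    (hcoarse' : ∀ (s : ↥(pbox M')) (m : Fin (d + 1)), ((s, Sum.inr m) : Idx M' (Fib d)) ∈ Set.range fμ' ↔ Torus.proj Lc (s : Site (d + 1)) = 0) :
    (kkt
      (effForm ((perF (fine Lc M') (bhKStepAt d (toSite r) Lc j)).submatrix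
            (fun b : ↥(pbox (fine Lc M')) × Fin (d + 1) => ((b.1, Sum.inl b.2) : Idx (fine Lc M') (Fib d)))
            (fun b : ↥(pbox (fine Lc M')) × Fin (d + 1) => ((b.1, Sum.inl b.2) : Idx (fine Lc M') (Fib d))))
          (fromRows
            ((perF (fine Lc M') (bhKStepAt d (toSite r) Lc j)).submatrix
              (fun a : ↥(pbox M') × Fin (d + 1) => ((cp a.1, Sum.inr a.2) : Idx (fine Lc M') (Fib d)))
              (fun b : ↥(pbox (fine Lc M')) × Fin (d + 1) => ((b.1, Sum.inl b.2) : Idx (fine Lc M') (Fib d))))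
            ((combRowsT (toSite r) Lc (fine Lc M')).submatrix id
              (fun b : ↥(pbox (fine Lc M')) × Fin (d + 1) => ((b.1, Sum.inl b.2) : Idx (fine Lc M') (Fib d)))))).toBlocks₁₁
      (fromRows
        ((perF M' (bhKStepAt d (toSite r') Lc (j + 1))).submatrix fμ' (fun b : ↥(pbox M') × Fin (d + 1) => ((b.1, Sum.inl b.2) : Idx M' (Fib d))))
        ((combRowsT (toSite r') Lc M').submatrix id (fun b : ↥(pbox M') × Fin (d + 1) => ((b.1, Sum.inl b.2) : Idx M' (Fib d)))))).det ≠ 0 :=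
  torus_h2 M' hr j hr' hM' (fun a : ↥(pbox M') × Fin (d + 1) => ((cp a.1, Sum.inr a.2) : Idx (fine Lc M') (Fib d))) hfμ
    (fun a => ⟨a.2, rfl⟩) hcoarse id (fun a => ⟨hcp a.1, rfl⟩) Function.bijective_id fμ' hfμ' hμ' hcoarse'

set_option synthInstance.maxSize 1024 in
/-- **[folklore] (ID) AT THE INDEX TYPES OF RECORD**: `(effForm H₀ [Q₁₀;τ₁]).toBlocks₁₁ = (wVH d Lc (j+1))⁻¹ • (perF M′ (bhKStepAt d (toSite r′) Lc (j+1)))∘(fields, fields)` — the `hId`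
of `RelInvPeriodisedCoarse.coarse_det_kkt_ne_zero_record` with `c = (wVH (j+1))⁻¹`. -/
theorem hId_order_zero_record (hr : r ∈ box (d + 1) Lc) (j : ℕ) (r' : Fin (d + 1) → ℕ)
    (cp : ↥(pbox M') → ↥(pbox (fine Lc M'))) (hcp : ∀ p : ↥(pbox M'), (cp p : Site (d + 1)) = (Lc : ℤ) • (p : Site (d + 1)))
    (hfμ : Function.Injective (fun a : ↥(pbox M') × Fin (d + 1) => ((cp a.1, Sum.inr a.2) : Idx (fine Lc M') (Fib d))))
    (hcoarse : ∀ (s : ↥(pbox (fine Lc M'))) (m : Fin (d + 1)),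
      ((s, Sum.inr m) : Idx (fine Lc M') (Fib d)) ∈ Set.range (fun a : ↥(pbox M') × Fin (d + 1) => ((cp a.1, Sum.inr a.2) : Idx (fine Lc M') (Fib d)))
        ↔ Torus.proj Lc (s : Site (d + 1)) = 0) :
    (effForm ((perF (fine Lc M') (bhKStepAt d (toSite r) Lc j)).submatrix
          (fun b : ↥(pbox (fine Lc M')) × Fin (d + 1) => ((b.1, Sum.inl b.2) : Idx (fine Lc M') (Fib d)))
          (fun b : ↥(pbox (fine Lc M')) × Fin (d + 1) => ((b.1, Sum.inl b.2) : Idx (fine Lc M') (Fib d))))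
        (fromRows
          ((perF (fine Lc M') (bhKStepAt d (toSite r) Lc j)).submatrix
            (fun a : ↥(pbox M') × Fin (d + 1) => ((cp a.1, Sum.inr a.2) : Idx (fine Lc M') (Fib d)))
            (fun b : ↥(pbox (fine Lc M')) × Fin (d + 1) => ((b.1, Sum.inl b.2) : Idx (fine Lc M') (Fib d))))
          ((combRowsT (toSite r) Lc (fine Lc M')).submatrix id
            (fun b : ↥(pbox (fine Lc M')) × Fin (d + 1) => ((b.1, Sum.inl b.2) : Idx (fine Lc M') (Fib d)))))).toBlocks₁₁
      = (wVH d Lc (j + 1))⁻¹ • (perF M' (bhKStepAt d (toSite r') Lc (j + 1))).submatrix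
          (fun b : ↥(pbox M') × Fin (d + 1) => ((b.1, Sum.inl b.2) : Idx M' (Fib d))) (fun b : ↥(pbox M') × Fin (d + 1) => ((b.1, Sum.inl b.2) : Idx M' (Fib d))) :=
  hId_order_zero M' hr j r' (fun a : ↥(pbox M') × Fin (d + 1) => ((cp a.1, Sum.inr a.2) : Idx (fine Lc M') (Fib d))) hfμ
    (fun a => ⟨a.2, rfl⟩) hcoarse id (fun a => ⟨hcp a.1, rfl⟩)

end Identification

end Summit.QuantumFields.BalabanUV.Beta.FP.RelInvPeriodisedEffFormCoarse

end
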